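import Summits.BirchSwinnertonDyer.BirchSwinnertonDyer.Theses.EdixhovenFibreFiveSeven
import Summits.BirchSwinnertonDyer.BirchSwinnertonDyer.Theorems.EdixhovenFibreFiveSevenStarredOptimalManinUnitFiveSevenAssemblyAt
import Summits.BirchSwinnertonDyer.BirchSwinnertonDyer.Theorems.EdixhovenFibreFiveSevenTwistDegreeStepOrdinaryLeverAtManinUnit
import Summits.BirchSwinnertonDyer.BirchSwinnertonDyer.Theorems.EdixhovenFibreFiveSevenStarredOptimalManinUnitFiveSevenOrdinaryCellsDeRham
import Literature.NumberTheory.EllipticCurves.IsogenyCompProofs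
import Literature.NumberTheory.PAdicHodge.KatoH1BdRFilHolds
import HarnessLib

/-!
# Crux TDS11 `TwistDegreeStepOrdinary` (stmt-BirchSwinnertonDyer-22228), route `EdixhovenFibreFiveSeven`: the route decl BY NAME
# GRANTED ONLY {P1, (S5b-tower)} — the de Rham binder hDR is DISCHARGED on TDS11's (G)-ordinary locus

Cell `pub/bsd-wall`, seat `bsd-line-edix-p4` g9 (WIDTH-5, lane (g) of memo
`Cruxes/StarredOptimalManinUnitFiveSeven/Lines/kato-lever-hDR-programme.md` v3.1 §3). TOOL theorem only (no definition, no named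
fact, no `sorry`, no local instance); `--supports` 22228 (helper); nothing is closed; BSD is not proved by any of this.

WHAT. The tree's conditional closers of TDS11 (`KatoSl2NeronClosersOfIsDeRham.twistDegreeStepOrdinary_of_isDeRham`, p637894
lineage) display THREE cite-only facts {P1 `Kato2004.exists_member_sl2ZetaElement_neron_values`, hT₂
`exists_smul_range_expStarCoord_tower_iff_trace_log`, hDR `isDeRham_restrictedRationalTateRep`}. TDS11 quantifies over frames
`(W, p ≥ 11)` carrying a (G)-ORDINARY member `V ∼ W` (`TypeGOrd V p`), and the universal hDR is consumed only at members of
that class (the `X₀(N)`-optimal member, via the tame-twist lever, and Kato's member, via the Pin theorem): there de Rham-ness is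
the tree THEOREM `isDeRham_restrictedRationalTateRep_adicCompletion_rat_of_typeGOrd` (edix-p4 g8, p646289, over dR-B8) moved
along the class by `DeRhamEllipticIsogeny.isDeRham_restrictedRationalTateRep_of_isIsogenous` (p650458). Hence

* ★★ `twistDegreeStepOrdinary_of_sl2NeronValues_of_expStarTower` — **TDS11 BY NAME from P1 and hT₂ ALONE** (Kato II Prop. 1.2.3
  = tree theorem `cupLogInjective_and_hasDualExp_of_isDeRham_holds`; de Rham per curve as above): per-class lever
  `ManinFrameResidueProperRTameTwistAt.twistDegreeStep_of_tameTwistL_at` fed, at every globally minimal `W₀ ∼ W`, with the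
  per-class socket `KatoAssemblySocketAt.katoNeronBody_of_sl2NeronValues_of_isDeRhamAt` at `W₀` (its `p ≥ 5` clause by `7 < p`).
CONDITIONAL on P1 / hT₂ (cite-only, XL); the item stays OPEN; its displayed print debt drops from 3 facts to 2.

References: [Kato2004Asterisque] (8.1.3) p. 180, Thm. 9.7 p. 189; [Kato1993LNM1553] Ch. II Prop. 1.2.3, Ex. 1.3.5, Thm. 1.4.1;
[KimNakamura2020] Cor. 2.4; [EdixhovenManin1991] §4; [BrinonConrad2009] Prop. 6.3.8; [SilvermanAEC2009] III.7.4.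
-/

set_option autoImplicit false
-- the Theorems namespace of a single-conjunct summit repeats the summit name by design (D-0017)
set_option linter.dupNamespace false

noncomputable section

open scoped Classical MatrixGroups NumberField

open WeierstrassCurve NumberField IsDedekindDomain Field ValuativeRel
  Literature.NumberTheory.EllipticCurves Literature.NumberTheory.EllipticCurves.ModularForms
  Literature.NumberTheory.EllipticCurves.Rank1Residual Literature.NumberTheory.EllipticCurves.Kato2004
  Literature.NumberTheory.DiophantineGeometry Rat.HeightOneSpectrum
  Literature.NumberTheory.PAdicHodge Literature.NumberTheory.GaloisRepresentations
  Literature.NumberTheory.GaloisRepresentations.IsNonarchimedeanLocalField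
  Summit.BirchSwinnertonDyer.Rank1Residual Summit.BirchSwinnertonDyer.Rank1Residual.Additive
  Summit.BirchSwinnertonDyer.BirchSwinnertonDyer.Theorems
  Summit.BirchSwinnertonDyer.BirchSwinnertonDyer.Theorems.KatoAssemblySocketAt
  Summit.BirchSwinnertonDyer.BirchSwinnertonDyer.Theorems.ManinFrameResidueProperRTameTwistAt
  CongruenceSubgroup Complex

namespace Summit.BirchSwinnertonDyer.BirchSwinnertonDyer.Theorems.TwistDegreeStepOrdinaryOfSL2NeronValues

/-- **TDS11 `TwistDegreeStepOrdinary` (stmt-BirchSwinnertonDyer-22228) GRANTED ONLY P1 and (S5b-tower)** — the de Rham input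
of Kato's argument is supplied PER CLASS by the tree theorem for (G)-ordinary curves
(`isDeRham_restrictedRationalTateRep_adicCompletion_rat_of_typeGOrd` at the frame's (G)-ordinary member `V`, moved to every
member `W₀ ∼ W ∼ V` by `isDeRham_restrictedRationalTateRep_of_isIsogenous`), Kato II Prop. 1.2.3 by
`cupLogInjective_and_hasDualExp_of_isDeRham_holds`; then the per-class socket and the per-class FULL tame-twist lever.
CONDITIONAL; the item is not closed by this. [cite: Kato2004Asterisque, (8.1.3) (p. 180), Thm. 9.7 (p. 189)]
[cite: EdixhovenManin1991, §4] [cite: Kato1993LNM1553, Ch. II Ex. 1.3.5] [cite: BrinonConrad2009, Prop. 6.3.8] -/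
theorem twistDegreeStepOrdinary_of_sl2NeronValues_of_expStarTower
    (hT₂ : exists_smul_range_expStarCoord_tower_iff_trace_log) (hP1 : exists_member_sl2ZetaElement_neron_values) :
    Summit.BirchSwinnertonDyer.BirchSwinnertonDyer.Theses.EdixhovenFibreFiveSeven.TwistDegreeStepOrdinary := by
  intro hnf W _ _ p _ _ hp11 hadd hirr _hres _hall V _ _ _ Wf _ _ _ C hisoV hG hV4 hC
  refine twistDegreeStep_of_tameTwistL_at hnf W hp11 hadd hirr ?_ V Wf C hisoV hG hV4 hC
  intro W₀ _ _ hiso₀ M _ g hg h7 hng hnm hirr' m _ hcop χ hχ hχ1 hord ϖ r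
  have hisoVW₀ : IsIsogenous V W₀ := (hisoV.symm_of_charZero).trans' hiso₀
  refine katoNeronBody_of_sl2NeronValues_of_isDeRhamAt hT₂ cupLogInjective_and_hasDualExp_of_isDeRham_holds hP1 W₀ p
    ?_ g hg (by omega) hng hnm hirr' m hcop (Or.inl h7) χ hχ hχ1 hord ϖ r
  intro v hpv _ _ _ hp' _
  exact isDeRham_restrictedRationalTateRep_of_isIsogenous hp' hisoVW₀
    (isDeRham_restrictedRationalTateRep_adicCompletion_rat_of_typeGOrd V p hG v hpv hp')

end Summit.BirchSwinnertonDyer.BirchSwinnertonDyer.Theorems.TwistDegreeStepOrdinaryOfSL2NeronValues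

end
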